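import Summits.CriticalPhenomena.Ising3DConformalLimit.Theses.PerfectScreening
import Literature.Probability.LatticeModels.CriticalScalingDimension
import Literature.Probability.LatticeModels.PointwiseScalingLimitEtaExists

/-!
# `GaussianLimitNotScreened` (stmt-CriticalPhenomena-13886) = (Δ = 1/2) ∧ (amplitude): the
# conclusion `¬(‖x‖G → 0)` is a property of the renormalisation `ρ` alone

Structural (positive) lemmas about the crux `…Theses.PerfectScreening.GaussianLimitNotScreened`
(r4 of route PerfectScreening), standing crux disprover (D-0016); THEOREM-ONLY, no definitions,
supports the item, closes nothing. With `Z_m := m / ρ(1/m)²` read at the lattice pair `(0, m e₁)`: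

* `screened_iff_renorm` — for ANY non-degenerate pointwise limit `(ρ, S)` of `criticalCorr 3`
  (no covariance needed): `‖x‖⟨σ₀σ_x⟩_{β_c} → 0 ↔ ρ(1/m)²/m → ∞` (`Z_m → 0`). Messager–Miracle-Solé
  (`criticalTwoPoint_axis_sandwich`) moves every direction onto the axis, where
  `ρ(1/m)² ⟨σ₀σ_{me₁}⟩ → S₂(0,e₀) > 0` (`HasPointwiseScalingLimit.tendsto_renorm_sq_mul_axis`).
* `dimension_window_and_eta` — with scale covariance: `Δ ∈ [1/2, 3/4]` and `η = 2Δ - 1` exists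
  (tree `exists_rpow_scale_mem_Icc_threeQuarters`, exponents identified at the reference pair).
* `screened_of_half_lt` — `Δ > 1/2` already forces perfect screening (so on the screened branch of
  the route's dichotomy only `Δ = 1/2` is ever at stake).
* `crux_iff_half_and_amplitude` — **the crux is EQUIVALENT to: every non-degenerate Möbius-covariant
  Gaussian (`U₄ ≡ 0`) pointwise limit of `criticalCorr 3` has `Δ = 1/2` AND `Z_m ↛ 0`** — the
  planner's undecomposed halves (i) 'a free limit of the n.n. model has `Δ = 1/2`' (Markov inheritance
  + Pitt 1971 / Kotani 1973; shared with `GaussianLimitIsFree`, stmt-CriticalPhenomena-2601) and (ii)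
  'at `Δ = 1/2` the wave-function renormalisation does not vanish' (amplitude rigidity, no known
  handle), now as a kernel-checked equivalence provers can split on.

Companion: `Negative/ModelBlind.lean` (the model-blind crux is false: a screened Wick witness with
free-field limit), and the crux work file `Cruxes/GaussianLimitNotScreened/Disproof.lean`.
-/

noncomputable section

namespace Summit.CriticalPhenomena.Ising3DConformalLimit.GaussianLimitNotScreenedNegative

open Literature.Probability.LatticeModels Filter Topology

section Reformulation

variable {ρ : ℝ → ℝ} {Δ : ℝ} {S : CorrFamily 3}

/-- `S₂(0, e₀) > 0` for a non-degenerate family. [folklore] -/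
theorem refPair_pos (hnd : IsNondegenerateTwoPoint S) :
    0 < S 2 ![0, EuclideanSpace.single (0 : Fin 3) (1:ℝ)] := by
  have hx₀ := refPair_mem_nonCoincident (d := 3) (by norm_num)
  have e0 : (⟨0, by norm_num⟩ : Fin 3) = 0 := rfl
  rw [e0] at hx₀
  exact hnd _ hx₀

/-- `‖y‖_∞ → ∞` along the cofinite filter of `ℤ³` (ℕ-valued form). [folklore] -/
theorem tendsto_supNorm_cofinite : Tendsto (fun y : Site 3 => Site.supNorm y) cofinite atTop := by
  have h := Site.tendsto_norm_cofinite_atTop (d := 3)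
  simp_rw [Site.norm_eq_supNorm] at h
  exact tendsto_natCast_atTop_iff.1 h

/-- Perfect screening read on the axis: `m ⟨σ₀σ_{m e₁}⟩ → 0`. [folklore] -/
theorem tendsto_axis_of_screened (h : Tendsto (fun x : Site 3 => ‖x‖ * criticalTwoPoint 3 x) cofinite (𝓝 0)) :
    Tendsto (fun m : ℕ => (m:ℝ) * criticalTwoPoint 3 (Pi.single 0 (m:ℤ))) atTop (𝓝 0) := by
  have hinj : Function.Injective (fun m : ℕ => (Pi.single 0 (m:ℤ) : Site 3)) := by
    intro a b hab
    have := congr_fun hab 0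
    simpa using this
  have h1 := h.comp (hinj.tendsto_cofinite.mono_left Nat.cofinite_eq_atTop.ge)
  refine h1.congr' (Eventually.of_forall fun m => ?_)
  simp only [Function.comp_apply, norm_single_axis, Int.cast_natCast, Nat.abs_cast]

/-- Conversely the axis controls every direction (MMS): `m ⟨σ₀σ_{m e₁}⟩ → 0 ⇒ ‖x‖G(x) → 0`. [folklore] -/
theorem screened_of_tendsto_axis
    (hax : Tendsto (fun m : ℕ => (m:ℝ) * criticalTwoPoint 3 (Pi.single 0 (m:ℤ))) atTop (𝓝 0)) :
    Tendsto (fun x : Site 3 => ‖x‖ * criticalTwoPoint 3 x) cofinite (𝓝 0) := by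
  have hup := hax.comp tendsto_supNorm_cofinite
  refine squeeze_zero' (Eventually.of_forall fun y =>
    mul_nonneg (norm_nonneg _) (criticalTwoPoint_nonneg' _)) ?_ hup
  filter_upwards [tendsto_supNorm_cofinite.eventually (eventually_ge_atTop 1)] with y hy
  obtain ⟨-, hle⟩ := criticalTwoPoint_axis_sandwich hy
  rw [Function.comp_apply, Site.norm_eq_supNorm]
  exact mul_le_mul_of_nonneg_left hle (Nat.cast_nonneg _)

/-- **Screening is a property of the renormalisation alone.** For a non-degenerate pointwise limit
`(ρ, S)` of `criticalCorr 3`: `‖x‖⟨σ₀σ_x⟩_{β_c} → 0 ↔ ρ(1/m)²/m → ∞` (i.e. `Z_m := m/ρ(1/m)² → 0`).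
[folklore] -/
theorem screened_iff_renorm (hlim : HasPointwiseScalingLimit (criticalCorr 3) ρ S)
    (hnd : IsNondegenerateTwoPoint S) :
    Tendsto (fun x : Site 3 => ‖x‖ * criticalTwoPoint 3 x) cofinite (𝓝 0) ↔
      Tendsto (fun m : ℕ => ρ (1 / m) ^ 2 / m) atTop atTop := by
  have hA := hlim.tendsto_renorm_sq_mul_axis
  have hs := refPair_pos hnd
  constructor
  · intro hscr
    have hB := tendsto_axis_of_screened hscr
    have hBpos : ∀ᶠ m : ℕ in atTop, 0 < (m:ℝ) * criticalTwoPoint 3 (Pi.single 0 (m:ℤ)) := by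
      filter_upwards [eventually_ge_atTop 1] with m hm
      exact mul_pos (by exact_mod_cast hm) (criticalTwoPoint_axis_pos m)
    have hBinv : Tendsto (fun m : ℕ => ((m:ℝ) * criticalTwoPoint 3 (Pi.single 0 (m:ℤ)))⁻¹) atTop atTop :=
      tendsto_inv_nhdsGT_zero.comp (tendsto_nhdsWithin_iff.2 ⟨hB, hBpos⟩)
    refine (hA.pos_mul_atTop hs hBinv).congr' ?_
    filter_upwards [eventually_ge_atTop 1] with m hm
    have hG := (criticalTwoPoint_axis_pos m).ne'
    have hm' : (m:ℝ) ≠ 0 := by positivity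
    field_simp
  · intro hT
    have h0 := hA.div_atTop hT
    apply screened_of_tendsto_axis
    refine h0.congr' ?_
    filter_upwards [hT.eventually_gt_atTop 0, eventually_ge_atTop 1] with m hpos hm
    have hρ : ρ (1 / m) ^ 2 ≠ 0 := by
      intro h; rw [h, zero_div] at hpos; exact lt_irrefl _ hpos
    have hρ' : ρ (1 / m) ≠ 0 := fun h => hρ (by rw [h]; ring)
    have hm' : (m:ℝ) ≠ 0 := by positivity
    field_simp

/-- The scaling dimension of a non-degenerate scale-covariant pointwise limit of `criticalCorr 3` lies
in `[1/2, 3/4]` and `η = 2Δ - 1` exists (tree: `exists_rpow_scale_mem_Icc_threeQuarters`, with the two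
exponents identified at the reference pair). [cite: DuminilCopinPanis2025LowerBounds, Theorem 1.5] -/
theorem dimension_window_and_eta (hρ : ∀ δ ∈ Set.Ioc (0:ℝ) 1, 0 < ρ δ)
    (hlim : HasPointwiseScalingLimit (criticalCorr 3) ρ S) (hnd : IsNondegenerateTwoPoint S)
    (hsc : IsScaleCovariant Δ S) :
    Δ ∈ Set.Icc (1/2 : ℝ) (3/4) ∧ HasIsingExponentEta 3 (2 * Δ - 1) := by
  obtain ⟨Δ', hΔ', hcov, -, hη⟩ := hlim.exists_rpow_scale_mem_Icc_threeQuarters hρ hnd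
  have hx₀ := refPair_mem_nonCoincident (d := 3) (by norm_num)
  set x₀ : Fin 2 → EuclideanSpace ℝ (Fin 3) := ![0, EuclideanSpace.single (⟨0, by norm_num⟩ : Fin 3) (1:ℝ)]
  have ha : 0 < S 2 x₀ := hnd _ hx₀
  have heq : Δ = Δ' := by
    have e₁ := hsc 2 2 two_pos x₀
    have e₂ := hcov 2 2 two_pos x₀ hx₀
    rw [e₁] at e₂
    have h := mul_right_cancel₀ ha.ne' e₂
    have h' := congrArg Real.log h
    rw [Real.log_rpow two_pos, Real.log_rpow two_pos] at h'
    have hl : Real.log 2 ≠ 0 := (Real.log_pos one_lt_two).ne'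
    have := mul_right_cancel₀ hl h'
    push_cast at this
    linarith
  subst heq
  exact ⟨hΔ', hη⟩

/-- **`Δ > 1/2` is automatically screened.** If a non-degenerate pointwise limit of `criticalCorr 3`
is scale covariant with `Δ > 1/2`, then `‖x‖⟨σ₀σ_x⟩_{β_c} → 0` (since `η = 2Δ - 1 > 0` exists in
the logarithmic sense). So on the screened branch the crux only ever has to exclude `Δ = 1/2`. [folklore] -/
theorem screened_of_half_lt (hρ : ∀ δ ∈ Set.Ioc (0:ℝ) 1, 0 < ρ δ)
    (hlim : HasPointwiseScalingLimit (criticalCorr 3) ρ S) (hnd : IsNondegenerateTwoPoint S)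
    (hsc : IsScaleCovariant Δ S) (hΔ : 1/2 < Δ) :
    Tendsto (fun x : Site 3 => ‖x‖ * criticalTwoPoint 3 x) cofinite (𝓝 0) := by
  obtain ⟨-, hη⟩ := dimension_window_and_eta hρ hlim hnd hsc
  -- hη : log G(y) / log ‖y‖ → -(3 - 2 + (2Δ - 1)) = -2Δ
  unfold HasIsingExponentEta HasSpatialDecayExponent at hη
  have hlim' : Tendsto (fun y : Site 3 => Real.log (criticalTwoPoint 3 y) / Real.log ‖y‖) cofinite
      (𝓝 (-(2 * Δ))) := by
    convert hη using 2; push_cast; ring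
  obtain ⟨κ, hκ1, hκ2⟩ : ∃ κ : ℝ, 1 < κ ∧ κ < 2 * Δ := ⟨(1 + 2 * Δ) / 2, by linarith, by linarith⟩
  have hnorm := Site.tendsto_norm_cofinite_atTop (d := 3)
  have hev1 : ∀ᶠ y : Site 3 in cofinite, Real.log (criticalTwoPoint 3 y) / Real.log ‖y‖ < -κ :=
    (tendsto_order.1 hlim').2 _ (by linarith)
  have hev2 : ∀ᶠ y : Site 3 in cofinite, 1 < ‖y‖ := hnorm.eventually (eventually_gt_atTop 1)
  -- the majorant ‖y‖^{1-κ} → 0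
  have hmaj : Tendsto (fun y : Site 3 => ‖y‖ ^ (1 - κ)) cofinite (𝓝 0) := by
    have := (tendsto_rpow_neg_atTop (by linarith : 0 < κ - 1)).comp hnorm
    refine this.congr' (Eventually.of_forall fun y => ?_)
    simp only [Function.comp_apply, neg_sub]
  refine squeeze_zero' (Eventually.of_forall fun y =>
    mul_nonneg (norm_nonneg _) (criticalTwoPoint_nonneg' _)) ?_ hmaj
  filter_upwards [hev1, hev2] with y h1 h2
  have hy0 : y ≠ 0 := by
    intro h; rw [h, norm_zero] at h2; linarith
  have hlog : 0 < Real.log ‖y‖ := Real.log_pos h2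
  have hGpos : 0 < criticalTwoPoint 3 y := by
    obtain ⟨c, C, hc, hbd⟩ := criticalTwoPoint_bounds_holds (d := 3) le_rfl
    exact lt_of_lt_of_le (mul_pos hc (Real.rpow_pos_of_pos (by linarith) _)) (hbd y hy0).1
  have h3 : Real.log (criticalTwoPoint 3 y) < -κ * Real.log ‖y‖ := by
    rwa [div_lt_iff₀ hlog] at h1
  have h4 : criticalTwoPoint 3 y < ‖y‖ ^ (-κ) := by
    rw [← Real.log_lt_log_iff hGpos (Real.rpow_pos_of_pos (by linarith) _), Real.log_rpow (by linarith)]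
    exact h3
  have hn0 : (0:ℝ) < ‖y‖ := by linarith
  calc ‖y‖ * criticalTwoPoint 3 y ≤ ‖y‖ * ‖y‖ ^ (-κ) := by gcongr
    _ = ‖y‖ ^ (1 - κ) := by
        rw [sub_eq_add_neg, Real.rpow_add hn0, Real.rpow_one]

/-- **THE CRUX, DECOMPOSED.** `GaussianLimitNotScreened ↔` every non-degenerate Möbius-covariant
Gaussian pointwise limit `(ρ, Δ, S)` of `criticalCorr 3` has (i) `Δ = 1/2` and (ii) its wave-function
renormalisation `Z_m = m/ρ(1/m)²` does NOT tend to `0` (`¬ ρ(1/m)²/m → ∞`). [folklore] -/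
theorem crux_iff_half_and_amplitude :
    Summit.CriticalPhenomena.Ising3DConformalLimit.Theses.PerfectScreening.GaussianLimitNotScreened ↔ ∀ (ρ : ℝ → ℝ) (Δ : ℝ) (S : CorrFamily 3), (∀ δ ∈ Set.Ioc (0:ℝ) 1, 0 < ρ δ) →
      HasPointwiseScalingLimit (criticalCorr 3) ρ S → IsNondegenerateTwoPoint S →
      IsMoebiusCovariant Δ S → ¬ HasNontrivialU4 S →
      (Δ = 1/2 ∧ ¬ Tendsto (fun m : ℕ => ρ (1 / m) ^ 2 / m) atTop atTop) := by
  constructor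
  · intro h ρ Δ S hρ hlim hnd hM hU4
    have hns : ¬ Tendsto (fun x : Site 3 => ‖x‖ * criticalTwoPoint 3 x) cofinite (𝓝 0) :=
      h ρ Δ S hρ hlim hnd hM hU4
    refine ⟨?_, fun hT => hns ((screened_iff_renorm hlim hnd).2 hT)⟩
    obtain ⟨hwin, -⟩ := dimension_window_and_eta hρ hlim hnd hM.isScaleCovariant
    by_contra hne
    have hlt : 1/2 < Δ := lt_of_le_of_ne hwin.1 (Ne.symm hne)
    exact hns (screened_of_half_lt hρ hlim hnd hM.isScaleCovariant hlt)
  · intro h ρ Δ S hρ hlim hnd hM hU4 hscr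
    obtain ⟨-, hT⟩ := h ρ Δ S hρ hlim hnd hM hU4
    exact hT ((screened_iff_renorm hlim hnd).1 hscr)

end Reformulation

end Summit.CriticalPhenomena.Ising3DConformalLimit.GaussianLimitNotScreenedNegative

end
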